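/-
Origin: expansion seat `planner-pub-hodgecm-pv09-g4-0`, handover #7 2026-08-18T07:41:23Z (`HOME/pub-hodgecm-pv09-g4/lean/Pv09g4/RallisHeadline.lean`, md5 f0bbb292, 189 lines);
landed by the gen-7 packager in gate run 26 as `HodgeCM/PerL34/RallisHeadline.lean` (import ^import Pv13g3\.→import HodgeCM.PerL34. ×1; import ^import Pv[0-9]+g[0-9]+\.→import HodgeCM.PerL34. ×1).
-/
/-
HodgeCM / PerL34 publication cell — seam S3 (pub-hodgecm-pv09-g4, HANDOVER #7).
Imports: `Pv13g3.RallisAdic` — pv13-g3's run-26 file #8 (CHECK-ONLY MIRROR in my dir) ↦ the tree name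
`HodgeCM.PerL34.RallisAdic`; `Pv09g4.RallisCompactDomain` (my run-26 #5) ↦ `HodgeCM.PerL34.RallisCompactDomain`.
Complete proofs, no new axioms, nothing cited.
-/
import Summits.HodgeConjecture.HodgeCM.PerL34.RallisAdic
import Summits.HodgeConjecture.HodgeCM.PerL34.RallisCompactDomain

/-!
# Seam S3 — the HEADLINE: `θ ≠ 0` and `Θ_φ(χ′) ≠ 0` with the `𝓕`-side and the per-place side BOTH discharged

pv13-g3's `SplitShells.theta_ne_zero_of_N31d_adic` / `thetaLift_ne_zero_of_N31d_adic` (= pv09-g4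
`theta_ne_zero_of_N31d` / `thetaLift_ne_zero_of_N31d` with the four per-place binders `X, hclS, hsum,
ram_pos` PRODUCED from definitional / choice / level / dictionary / isotypy data over the completions
`L_{0,v}`) still take the fundamental domain: `{𝓕} (h𝓕 : IsFundamentalDomain jA.range 𝓕 μ)`,
`vol_ne_top`, `[Countable (unitary L)]`, `[IsFiniteMeasure (μ.restrict 𝓕)]`.  Here those are DISCHARGED from
the two set-up facts "`U(W_i)(L₀)` discrete and cocompact in `U(W_i)(𝔸)`" (instances on `jA.range`) by
pv09-g4 `exists_compactDomain_haarDatum` (a COMPACT fundamental domain with non-empty interior, positive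
finite volume):

* `exists_compactDomain_theta_ne_zero_of_N31d_adic` — `∃ 𝓕, IsCompact 𝓕 ∧ (interior 𝓕).Nonempty ∧
  MeasurableSet 𝓕 ∧ IsFundamentalDomain jA.range 𝓕 μ ∧ μ 𝓕 ≠ 0 ∧ μ 𝓕 ≠ ⊤ ∧ ∀ θ ∈ Θ, ⟪θ,θ⟫ = ∫_𝓕∫_𝓕 χ′ χ̄′ K_θ
  → θ ≠ 0` (`K_θ` = the theta kernel of pv05's doubling datum);
* `exists_compactDomain_thetaLift_ne_zero_of_N31d_adic` — same `𝓕`, and for it the GENUINE THETA LIFT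
  `Θ_φ(χ′) = ∫_𝓕 θ_φ(·,u) χ′(u) du ∈ L²([G_U])` is non-zero, for every measurable bounded theta function
  (`hk`, `hkC`: the two measurability/boundedness inputs of pv09-g3's Petersson–Fubini step); the instance
  `IsFiniteMeasure (μ.restrict 𝓕)` the lift needs is a binder of the conclusion and is provided by
  `isFiniteMeasure_restrict_haarDatum` from the exported `IsCompact 𝓕` (see `isFiniteMeasure_restrict_of_isCompact`).

What the headline still takes GLOBALLY: the two set-up instances (kernel for the idelic model, pv11-g4;
the model bridge to `Πʳ_v U(W_i)(L₀,v)` is SET-UP not in the tree), pv05's doubling datum `D` with `hP`,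
pv15's `G_U`-side data and `GluePrintInputs` (node N31d), the rational set-up `hW hh jA hjA j hj χ hχΓ hχVΓ`,
and PER PLACE exactly the data listed in pv13-g3's END FORM docstring.
-/

set_option autoImplicit false

noncomputable section

open MeasureTheory MeasureTheory.Measure Set Metric Function Complex ComplexConjugate
open scoped RestrictedProduct InnerProductSpace NNReal ENNReal

namespace HodgeCM.PerL34.PureTensor

open HodgeCM.PerL34.SplitShells HodgeCM.PerL34.AdelicFactorisation HodgeCM.PerL34.RestrictedMeasure
open HodgeCM.PerL34.NoSmallSubgroups HodgeCM.PerL34.EulerFactorisation HodgeCM.PerL34.DiscreteFD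
open HodgeCM.PerL34.LocalFactors HodgeCM.PerL34.LocalFactors.DilationModel
open HodgeCM.PerL34.LocalModulus HodgeCM.PerL34.SplitPlaceDilation
open HodgeCM.PerL34.RallisIP HodgeCM.PerL34.Doubling HodgeCM.PerL34.N31d

attribute [local instance] LocalFactors.DilationModel.Adic.nontriviallyNormedField
  LocalFactors.DilationModel.Adic.properSpace

section infra

variable {ι : Type} {G : ι → Type} [∀ i, CommGroup (G i)] [∀ i, TopologicalSpace (G i)]
  [∀ i, IsTopologicalGroup (G i)] [∀ i, T2Space (G i)] [∀ i, SecondCountableTopology (G i)]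
  [∀ i, MeasurableSpace (G i)] [∀ i, BorelSpace (G i)] [Countable ι]
  (B : ∀ i, Subgroup (G i)) (hBc : ∀ i, IsCompact (B i : Set (G i)))
  (hBo : ∀ i, IsOpen (B i : Set (G i))) (S₀ : Finset ι)

/-- A compact `𝓕` has finite Haar volume, as the instance the theta lift needs. -/
theorem isFiniteMeasure_restrict_of_isCompact {𝓕 : Set (Πʳ i, [G i, B i])} (h𝓕c : IsCompact 𝓕) :
    IsFiniteMeasure (((haarDatum B hBc hBo S₀).μ).restrict 𝓕) :=
  isFiniteMeasure_restrict_haarDatum B hBc hBo S₀ (by rw [h𝓕c.isClosed.closure_eq]; exact h𝓕c)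

end infra

section headline

variable {ι : Type} {G : ι → Type} [∀ i, CommGroup (G i)] [∀ i, TopologicalSpace (G i)]
  [∀ i, IsTopologicalGroup (G i)] [∀ i, T2Space (G i)] [∀ i, SecondCountableTopology (G i)]
  [∀ i, LocallyCompactSpace (G i)] [∀ i, MeasurableSpace (G i)] [∀ i, BorelSpace (G i)]
  [Countable ι] [DecidableEq ι]
  (B : ∀ i, Subgroup (G i)) (hBc : ∀ i, IsCompact (B i : Set (G i)))
  (hBo : ∀ i, IsOpen (B i : Set (G i))) (S₀ : Finset ι)
  {Sp : Type} [NormedAddCommGroup Sp] [InnerProductSpace ℂ Sp]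
  {E : Type*} [NormedAddCommGroup E] [InnerProductSpace ℂ E]
  -- pv05's doubling datum over `A := Πʳ_i [G_i, B_i]` and pv15's `G_U`-side data (DATA, D4)
  {L : Type} [Field L] [StarRing L] {W : Type} [AddCommGroup W] [Module L W]
  {H Sbox : Type} [Group H] [AddCommGroup Sbox] [Module ℂ Sbox]
  {h : W →ₗ⋆[L] W →ₗ[L] L} (hW : IsLine L W) (hh : Anisotropic h)
  (D : DoublingDatum (Πʳ j, [G j, B j]) H Sp Sbox) (GU : ThetaSide Sp Sbox)
  -- rational set-up: `U(W_i)(L₀) ↪ U(W_i)(𝔸)` DISCRETE and COCOMPACT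
  (jA : unitary L →* Πʳ j, [G j, B j]) (hjA : Function.Injective jA)
  [DiscreteTopology (jA.range : Subgroup (Πʳ j, [G j, B j]))]
  [CompactSpace ((Πʳ j, [G j, B j]) ⧸ (jA.range : Subgroup (Πʳ j, [G j, B j])))]
  (j : isomBox h →* H) (hj : ∀ d : unitary L, j ⟨iotaSnd d, iotaSnd_mem h d⟩ = D.ι (1, jA d))
  (χ : (Πʳ j, [G j, B j]) →* Circle) (hχΓ : ∀ d : unitary L, χ (jA d) = 1)
  (hχVΓ : ∀ d : unitary L, D.χV (jA d) = 1)
  -- N31d's print inputs (pv15 `GluePrintInputs`) and pv05's `hP`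
  {hP : ∀ Ψ : Sbox, ∀ p ∈ (stabDelta L W).subgroupOf (isomBox h), ∀ x : H,
    D.fSW Ψ (j p * x) = D.fSW Ψ x}
  (P : GluePrintInputs D GU h j hP) (φ : Sp)
  (hφ : ‖φ‖ = 1)
  (hloc : ∀ (i : ι) (v : Sp), Continuous fun g : G i => D.ω (RestrictedProduct.mulSingle B i g) v)
  {T' : Finset ι} (hχT' : RestrictedProduct.boxSubgroup B T' ≤ χ.ker)
  (hlocχ : ∀ i ∈ T', Continuous fun g : G i => χ (RestrictedProduct.mulSingle B i g))
  {T : Finset ι} (hK : ∀ k ∈ RestrictedProduct.boxSubgroup B T, D.ω k φ = φ)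
  (hM : ∀ S : Finset ι, T ⊆ S → ∀ y : (i : ↥S) → G i,
    inner ℂ φ (D.ω (extendOne B S y) φ) = ∏ i : ↥S, localCoeff B D.ω φ i (y i))
  {S : Finset ι} {IsSplit : ι → Prop} (hTS : T ⊆ S) (hT'S : T' ⊆ S)
  -- per-place data over the completions `L_{0,v}` (pv13-g3 / pv07-g2), verbatim from `RallisAdic`
  (L₀ : Type) [Field L₀] [NumberField L₀]
  (w : ι → IsDedekindDomain.HeightOneSpectrum (NumberField.RingOfIntegers L₀))
  (hw : ∀ ⦃i j : ι⦄, i ∉ S → j ∉ S → w i = w j → i = j)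
  [∀ i, MeasurableSpace ((w i).adicCompletion L₀)] [∀ i, BorelSpace ((w i).adicCompletion L₀)]
  (ν : ∀ i, ((w i).adicCompletion L₀)ˣ →* Circle)
  (hBi : ∀ i, i ∉ S → ¬IsSplit i → (B i : Set (G i)) = Set.univ)
  (ord : ∀ i, G i →* Multiplicative ℤ) (ϖ : ∀ i, G i) (ϖF : ∀ i, ((w i).adicCompletion L₀)ˣ)
  (hϖF : ∀ i, i ∉ S → IsUniformizer (ϖF i))
  (ord_ϖ : ∀ i, i ∉ S → IsSplit i → ord i (ϖ i) = Multiplicative.ofAdd 1)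
  (ker_ord : ∀ i, i ∉ S → IsSplit i → ∀ g : G i, ord i g = 1 ↔ g ∈ B i)
  (hν : ∀ i, i ∉ S → IsSplit i → ∀ u : ((w i).adicCompletion L₀)ˣ,
    ‖(u : (w i).adicCompletion L₀)‖ = 1 → ν i u = 1)
  (coeff_eq : ∀ i, i ∉ S → IsSplit i → ∀ n : ℤ, localCoeff B D.ω φ i (ϖ i ^ n)
    = ⟪ballIndicator (Adic.muV L₀ (w i)) 0 1,
        dilationRep (Adic.muV L₀ (w i)) (ν i) (ϖF i ^ n) (ballIndicator (Adic.muV L₀ (w i)) 0 1)⟫_ℂ)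
  (τ : ∀ i, i ∈ S → IsSplit i → (G i ≃ₜ* ((w i).adicCompletion L₀)ˣ))
  (x₀ : ∀ i, Fin 3 → (w i).adicCompletion L₀) (r cS : ι → ℝ)
  (hr : ∀ i ∈ S, IsSplit i → r i < ‖x₀ i‖) (hr0 : ∀ i ∈ S, IsSplit i → 0 < r i)
  (hcS : ∀ i ∈ S, IsSplit i → 0 < cS i)
  (hνS : ∀ i ∈ S, IsSplit i → ∀ y : ((w i).adicCompletion L₀)ˣ,
    (y : (w i).adicCompletion L₀) ∈ U1 (x₀ i) (r i) → ν i y = 1)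
  (hχS : ∀ i (hi : i ∈ S) (hs : IsSplit i), ∀ g : G i,
    ((τ i hi hs g : ((w i).adicCompletion L₀)ˣ) : (w i).adicCompletion L₀) ∈ U1 (x₀ i) (r i) →
      χ (RestrictedProduct.mulSingle B i g) = 1)
  (coeffS : ∀ i (hi : i ∈ S) (hs : IsSplit i), ∀ g : G i, localCoeff B D.ω φ i g
    = (cS i : ℂ) * ⟪ballIndicator (Adic.muV L₀ (w i)) (x₀ i) (r i),
        dilationRep (Adic.muV L₀ (w i)) (ν i) (τ i hi hs g) (ballIndicator (Adic.muV L₀ (w i)) (x₀ i) (r i))⟫_ℂ)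
  (hcpt : ∀ i ∈ S, ¬IsSplit i → CompactSpace (G i))
  (hiso : ∀ i ∈ S, ¬IsSplit i → ∀ g : G i, D.ω (RestrictedProduct.mulSingle B i g) φ
    = conj (((χ (RestrictedProduct.mulSingle B i g) : Circle) : ℂ)) • φ)

include hW hh hjA hj hχΓ hχVΓ P hφ hloc hχT' hlocχ hK hM hTS hT'S hw hBi hϖF ord_ϖ ker_ord hν
  coeff_eq hr hr0 hcS hνS hχS coeffS hcpt hiso

/-- **HEADLINE (kernel form): `θ ≠ 0` from node N31d and per-place definitional data, the fundamental
domain PRODUCED** — pv13-g3 `theta_ne_zero_of_N31d_adic` with `h𝓕`, `vol_ne_top`, `[Countable (unitary L)]`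
discharged from "`U(W_i)(L₀)` discrete and cocompact"; `𝓕` is compact with non-empty interior. -/
theorem exists_compactDomain_theta_ne_zero_of_N31d_adic :
    ∃ 𝓕 : Set (Πʳ j, [G j, B j]), IsCompact 𝓕 ∧ (interior 𝓕).Nonempty ∧ MeasurableSet 𝓕 ∧
      IsFundamentalDomain jA.range 𝓕 (haarDatum B hBc hBo S₀).μ ∧
      (haarDatum B hBc hBo S₀).μ 𝓕 ≠ 0 ∧ (haarDatum B hBc hBo S₀).μ 𝓕 ≠ ⊤ ∧
      ∀ (θ : E) (Θ : Set E), θ ∈ Θ →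
        ⟪θ, θ⟫_ℂ = ∫ u in 𝓕, ∫ u' in 𝓕, ((χ u : Circle) : ℂ) * conj ((χ u' : Circle) : ℂ) *
          thetaKernel D GU φ u u' ∂(haarDatum B hBc hBo S₀).μ ∂(haarDatum B hBc hBo S₀).μ → θ ≠ 0 := by
  classical
  haveI : Countable (jA.range : Subgroup (Πʳ j, [G j, B j])) :=
    countable_of_discrete_rp B hBo jA.range
  haveI : Countable (unitary L) := Countable.of_equiv _ (MonoidHom.ofInjective hjA).toEquiv.symm
  obtain ⟨𝓕, hc, hi, hm, hfd, h0, htop⟩ :=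
    exists_compactDomain_haarDatum B hBc hBo S₀ (jA.range : Subgroup (Πʳ j, [G j, B j]))
  exact ⟨𝓕, hc, hi, hm, hfd, h0, htop, fun θ Θ hθ hnorm =>
    theta_ne_zero_of_N31d_adic B hBc hBo S₀ hW hh D GU jA hjA j hj hfd χ hχΓ hχVΓ P φ hφ hloc hχT' hlocχ
      hK hM hTS hT'S L₀ w hw ν hBi ord ϖ ϖF hϖF ord_ϖ ker_ord hν coeff_eq τ x₀ r cS hr hr0 hcS hνS hχS
      coeffS hcpt hiso htop θ Θ hθ hnorm⟩

/-- **HEADLINE (Lemma 4.2(b) / Prop. 3.4: the theta lift `Θ_φ(χ′)` is non-zero), the fundamental domain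
PRODUCED** — pv13-g3 `thetaLift_ne_zero_of_N31d_adic` with `h𝓕`, `[Countable (unitary L)]` discharged from
"`U(W_i)(L₀)` discrete and cocompact"; `𝓕` is compact with non-empty interior, of positive finite volume; the
finite-measure instance of `μ|_𝓕` is a binder of the conclusion (`isFiniteMeasure_restrict_of_isCompact`). -/
theorem exists_compactDomain_thetaLift_ne_zero_of_N31d_adic [IsFiniteMeasure GU.μ] :
    ∃ 𝓕 : Set (Πʳ j, [G j, B j]), IsCompact 𝓕 ∧ (interior 𝓕).Nonempty ∧ MeasurableSet 𝓕 ∧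
      IsFundamentalDomain jA.range 𝓕 (haarDatum B hBc hBo S₀).μ ∧
      (haarDatum B hBc hBo S₀).μ 𝓕 ≠ 0 ∧ (haarDatum B hBc hBo S₀).μ 𝓕 ≠ ⊤ ∧
      ∀ [IsFiniteMeasure (((haarDatum B hBc hBo S₀).μ).restrict 𝓕)]
        (hk : Measurable (Function.uncurry (thetaFn D GU φ))) {Ck : ℝ} (hCk : 0 ≤ Ck)
        (hkC : ∀ q u, ‖thetaFn D GU φ q u‖ ≤ Ck),
        PeterssonFubini.theta GU.μ (((haarDatum B hBc hBo S₀).μ).restrict 𝓕) hk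
          (measurable_coe_char B hBo χ hχT' hlocχ) hCk hkC (norm_coe_char_le χ) ≠ 0 := by
  classical
  haveI : Countable (jA.range : Subgroup (Πʳ j, [G j, B j])) :=
    countable_of_discrete_rp B hBo jA.range
  haveI : Countable (unitary L) := Countable.of_equiv _ (MonoidHom.ofInjective hjA).toEquiv.symm
  obtain ⟨𝓕, hc, hi, hm, hfd, h0, htop⟩ :=
    exists_compactDomain_haarDatum B hBc hBo S₀ (jA.range : Subgroup (Πʳ j, [G j, B j]))
  refine ⟨𝓕, hc, hi, hm, hfd, h0, htop, ?_⟩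
  intro _ hk Ck hCk hkC
  exact thetaLift_ne_zero_of_N31d_adic B hBc hBo S₀ hW hh D GU jA hjA j hj hfd χ hχΓ hχVΓ P φ hφ hloc hχT'
    hlocχ hK hM hTS hT'S L₀ w hw ν hBi ord ϖ ϖF hϖF ord_ϖ ker_ord hν coeff_eq τ x₀ r cS hr hr0 hcS hνS hχS
    coeffS hcpt hiso hk hCk hkC

end headline

end HodgeCM.PerL34.PureTensor

end
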